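import Literature.Geometry.Symplectic.SphereACData
import Literature.Geometry.Symplectic.CauchyRiemannExpression
import Literature.Geometry.Symplectic.PlaneComplexStructureNormaliser
import Literature.Analysis.Complex.ProjectiveLineExpChart
import HarnessLib

/-!
# The Cauchy–Riemann operator of a sphere in `ℂℙ¹ × ℂ`, pointwise in the two charts

Layer B4b (pointwise part) of the analytic core of the Hofer–Lizan–Sikorav local foliation
theorem (Wendl 2018, Thm. 2.46 / Prop. 2.53), as used by the lead of crux `WitnessCharge`
(summit `SmoothPoincare4`). An almost complex structure on `ℂℙ¹ × ℂ` (or on a product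
neighbourhood of an embedded `J`-sphere) is given by its two chart expressions
`J₀, J₁ : ℂ × ℂ → End_ℝ(ℂ × ℂ)` in the coordinates `(Z, t)` and `(W, t)`, `W = Z⁻¹`, related
by the chart change `psi (Z, t) = (Z⁻¹, t)` (`SphereACData`), and such that the zero section
with its chart parametrisations is `J`-holomorphic (`axis₀`, `axis₁`).

A map from the Riemann sphere close to the zero section is described by a vector field `ξ`
(chart representatives `ξ₀`, `ξ₁ w = -w² ξ₀ w⁻¹`) and a function `f` (`f₁ w = f₀ w⁻¹`): in chart
`i` it reads `vmap_i ξ_i f_i z = (expChart z (ξ_i z), Q_i(z)⁻¹ (f_i z))`, where `expChart` is the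
equivariant exponential chart of `ℂℙ¹` (`ProjectiveLineExpChart`) and `Q_i` the normaliser
(`PlaneComplexStructure.normaliser`) of the complex structure induced on the normal direction
along the zero section, so that in the unknown `f` the normal complex structure is `i`.

The **Cauchy–Riemann operator in chart `i`** is
`crOp_i ξ f z = Φ_i z (crExpr J_i (vmap_i ξ f) z)`, the Cauchy–Riemann expression transported to
the fixed bundle `T ℂℙ¹ ⊕ ℂ` by the complex-linear part `Φ_i` of `diag(P⁻¹, Q_i)`, `P` the
`c`-derivative of `expChart`. MAIN RESULT (`crOp₁_eq`): on the overlap the two chart expressions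
satisfy EXACTLY the clutching relations of `(0,1)`-forms with values in `T ℂℙ¹ ⊕ ℂ`,

  `crOp₁ ξ₁ f₁ w = ((w² / w̄²) (crOp₀ ξ₀ f₀ z).1, (-w̄⁻²) (crOp₀ ξ₀ f₀ z).2)`, `w = z⁻¹`,

so that the pair of chart expressions is a section of a FIXED Banach bundle of Hölder sections
(`RiemannSphereHolderSections`) — the setting of the implicit function theorem. Also:
`crOp_i = 0 ↔ crExpr = 0` (`Φ_i` is invertible near the zero section) and the value on the zero
section is `0`.

## References

* C. Wendl, *Holomorphic Curves in Low Dimensions*, LNM 2216 (2018), §2.3, Thm. 2.46. [Wendl2018]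
* D. McDuff, D. Salamon, *J-holomorphic Curves and Symplectic Topology*, 2nd ed. (2012), §2.2,
  §3.1. [McDuffSalamon2012]
-/

noncomputable section

open Complex Set Filter
open scoped Topology ContDiff
open Literature.Analysis.Complex.ProjectiveLineExpChart Literature.Geometry.Symplectic.CRExpression
  Literature.Geometry.Symplectic.PlaneComplexStructure

namespace Literature.Geometry.Symplectic

namespace SphereCR

namespace SphereACData

variable (𝒥 : SphereACData)

/-- The normaliser of the normal structure, chart `0`: `Q₀ Z ∘ D₀ Z = I • Q₀ Z`.
[cite: Wendl2018, §2.3] -/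
def Q₀ (Z : ℂ) : ℂ →L[ℝ] ℂ := normaliser (𝒥.nrm₀ Z)

/-- The normaliser of the normal structure, chart `1`. [cite: Wendl2018, §2.3] -/
def Q₁ (W : ℂ) : ℂ →L[ℝ] ℂ := normaliser (𝒥.nrm₁ W)

/-- On the overlap `Q₁ W = Q₀ W⁻¹`. [folklore] -/
theorem Q₁_eq (W : ℂ) (hW : W ≠ 0) : 𝒥.Q₁ W = 𝒥.Q₀ W⁻¹ := by
  rw [Q₁, Q₀, 𝒥.nrm₁_eq W hW]

/-- The inverse normalisers. [folklore] -/
def Qinv₀ (Z : ℂ) : ℂ →L[ℝ] ℂ := Ring.inverse (𝒥.Q₀ Z)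

/-- The inverse normalisers, chart `1`. [folklore] -/
def Qinv₁ (W : ℂ) : ℂ →L[ℝ] ℂ := Ring.inverse (𝒥.Q₁ W)

/-- On the overlap `Qinv₁ W = Qinv₀ W⁻¹`. [folklore] -/
theorem Qinv₁_eq (W : ℂ) (hW : W ≠ 0) : 𝒥.Qinv₁ W = 𝒥.Qinv₀ W⁻¹ := by
  rw [Qinv₁, Qinv₀, 𝒥.Q₁_eq W hW]

/-- `Q₀` is smooth in `Z`. [folklore] -/
theorem contDiff_Q₀ : ContDiff ℝ ∞ 𝒥.Q₀ := by
  have hD : ContDiff ℝ ∞ 𝒥.nrm₀ := by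
    unfold nrm₀
    refine ContDiff.clm_comp contDiff_const (ContDiff.clm_comp ?_ contDiff_const)
    exact 𝒥.smooth₀.comp (contDiff_id.prodMk contDiff_const)
  have h := contDiffOn_normaliser_comp (E := ℂ) (s := univ) isPreconnected_univ (n := ⊤)
    hD.contDiffOn (fun Z _ t => 𝒥.nrm₀_sq Z t)
  exact contDiffOn_univ.1 h

/-- `Q₁` is smooth in `W`. [folklore] -/
theorem contDiff_Q₁ : ContDiff ℝ ∞ 𝒥.Q₁ := by
  have hD : ContDiff ℝ ∞ 𝒥.nrm₁ := by
    unfold nrm₁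
    refine ContDiff.clm_comp contDiff_const (ContDiff.clm_comp ?_ contDiff_const)
    exact 𝒥.smooth₁.comp (contDiff_id.prodMk contDiff_const)
  have h := contDiffOn_normaliser_comp (E := ℂ) (s := univ) isPreconnected_univ (n := ⊤)
    hD.contDiffOn (fun W _ t => 𝒥.nrm₁_sq W t)
  exact contDiffOn_univ.1 h

/-- `Qinv₀` is smooth and inverts `Q₀`. [folklore] -/
theorem contDiff_Qinv₀_and :
    ContDiff ℝ ∞ 𝒥.Qinv₀ ∧ ∀ Z, 𝒥.Qinv₀ Z * 𝒥.Q₀ Z = 1 ∧ 𝒥.Q₀ Z * 𝒥.Qinv₀ Z = 1 := by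
  have hD : ContDiff ℝ ∞ 𝒥.nrm₀ := by
    unfold nrm₀
    refine ContDiff.clm_comp contDiff_const (ContDiff.clm_comp ?_ contDiff_const)
    exact 𝒥.smooth₀.comp (contDiff_id.prodMk contDiff_const)
  obtain ⟨h1, h2⟩ := contDiffOn_inverse_normaliser_comp (E := ℂ) (s := univ) isPreconnected_univ
    (n := ⊤) hD.contDiffOn (fun Z _ t => 𝒥.nrm₀_sq Z t)
  exact ⟨contDiffOn_univ.1 h1, fun Z => h2 Z (mem_univ Z)⟩

/-- `Qinv₁` is smooth and inverts `Q₁`. [folklore] -/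
theorem contDiff_Qinv₁_and :
    ContDiff ℝ ∞ 𝒥.Qinv₁ ∧ ∀ W, 𝒥.Qinv₁ W * 𝒥.Q₁ W = 1 ∧ 𝒥.Q₁ W * 𝒥.Qinv₁ W = 1 := by
  have hD : ContDiff ℝ ∞ 𝒥.nrm₁ := by
    unfold nrm₁
    refine ContDiff.clm_comp contDiff_const (ContDiff.clm_comp ?_ contDiff_const)
    exact 𝒥.smooth₁.comp (contDiff_id.prodMk contDiff_const)
  obtain ⟨h1, h2⟩ := contDiffOn_inverse_normaliser_comp (E := ℂ) (s := univ) isPreconnected_univ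
    (n := ⊤) hD.contDiffOn (fun W _ t => 𝒥.nrm₁_sq W t)
  exact ⟨contDiffOn_univ.1 h1, fun W => h2 W (mem_univ W)⟩

/-- `Q₀ Z (Qinv₀ Z t) = t`. [folklore] -/
@[simp] theorem Q₀_Qinv₀ (Z t : ℂ) : 𝒥.Q₀ Z (𝒥.Qinv₀ Z t) = t := by
  have h := (𝒥.contDiff_Qinv₀_and.2 Z).2
  simpa using congrArg (fun T : ℂ →L[ℝ] ℂ => T t) h

/-- `Qinv₀ Z (Q₀ Z t) = t`. [folklore] -/
@[simp] theorem Qinv₀_Q₀ (Z t : ℂ) : 𝒥.Qinv₀ Z (𝒥.Q₀ Z t) = t := by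
  have h := (𝒥.contDiff_Qinv₀_and.2 Z).1
  simpa using congrArg (fun T : ℂ →L[ℝ] ℂ => T t) h

/-- `Q₀` conjugates the normal structure to `I`: `Q₀ Z (D₀ Z t) = I * Q₀ Z t`. [cite: Wendl2018, §2.3] -/
theorem Q₀_nrm₀ (Z t : ℂ) : 𝒥.Q₀ Z (𝒥.nrm₀ Z t) = I * 𝒥.Q₀ Z t :=
  normaliser_apply_D (fun t => 𝒥.nrm₀_sq Z t) t

/-! ### The map in the two charts and the `c`-derivative factor `P` -/

/-- The `c`-derivative of the exponential chart, `P z c = (1 + |z|²)² / den z c ²`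
(`hasDerivAt_expChart`). [folklore] -/
def _root_.Literature.Geometry.Symplectic.SphereCR.P (z c : ℂ) : ℂ :=
  (1 + (Complex.normSq z : ℂ)) ^ 2 / den z c ^ 2

/-- At `c = 0`, `P = 1`. [folklore] -/
theorem _root_.Literature.Geometry.Symplectic.SphereCR.P_zero (z : ℂ) : P z 0 = 1 := by
  rw [P, den_zero, div_self (pow_ne_zero 2 (one_add_normSq_ne_zero z))]

/-- `P ≠ 0` wherever `den ≠ 0`. [folklore] -/
theorem _root_.Literature.Geometry.Symplectic.SphereCR.P_ne_zero {z c : ℂ} (h : den z c ≠ 0) :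
    P z c ≠ 0 :=
  div_ne_zero (pow_ne_zero 2 (one_add_normSq_ne_zero z)) (pow_ne_zero 2 h)

/-- **Equivariance of `P`**: with `w = z⁻¹`, `c₁ = -w² c`,
`P w c₁ * (expChart z c)² = z² * P z c`. [folklore] -/
theorem _root_.Literature.Geometry.Symplectic.SphereCR.P_inv {z c : ℂ} (hz : z ≠ 0)
    (hden : den z c ≠ 0) (hnum : z * (1 + (Complex.normSq z : ℂ)) + c ≠ 0) :
    P z⁻¹ (-(z⁻¹) ^ 2 * c) * expChart z c ^ 2 = z ^ 2 * P z c := by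
  have hzc : (starRingEnd ℂ) z ≠ 0 := (map_ne_zero _).mpr hz
  have hN : (1 + (Complex.normSq z : ℂ)) ≠ 0 := one_add_normSq_ne_zero z
  have hnum' : (1 + (Complex.normSq z : ℂ)) * z + c ≠ 0 := by rwa [mul_comm] at hnum
  have h1 : (1 + (Complex.normSq z⁻¹ : ℂ)) =
      (1 + (Complex.normSq z : ℂ)) * ((z⁻¹) * ((starRingEnd ℂ) z)⁻¹) := by
    simp only [map_inv₀, Complex.ofReal_inv, ← Complex.mul_conj]
    field_simp
    ring
  rw [P, P, den_inv hz, h1, expChart]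
  field_simp

/-- The map near the zero section in chart `0`: `z ↦ (expChart z (ξ₀ z), Q₀(z)⁻¹ (f₀ z))`.
[cite: Wendl2018, §2.3] -/
def vmap₀ (ξ₀ f₀ : ℂ → ℂ) (z : ℂ) : ℂ × ℂ := (expChart z (ξ₀ z), 𝒥.Qinv₀ z (f₀ z))

/-- The map near the zero section in chart `1`. [cite: Wendl2018, §2.3] -/
def vmap₁ (ξ₁ f₁ : ℂ → ℂ) (w : ℂ) : ℂ × ℂ := (expChart w (ξ₁ w), 𝒥.Qinv₁ w (f₁ w))

/-- The transport matrix `diag(P⁻¹, Q₀ z)` in chart `0`. [cite: Wendl2018, §2.3] -/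
def Mmat₀ (ξ₀ : ℂ → ℂ) (z : ℂ) : ℂ × ℂ →L[ℝ] ℂ × ℂ :=
  ((((P z (ξ₀ z))⁻¹) • ContinuousLinearMap.id ℂ ℂ).restrictScalars ℝ).prodMap (𝒥.Q₀ z)

/-- The transport matrix in chart `1`. [cite: Wendl2018, §2.3] -/
def Mmat₁ (ξ₁ : ℂ → ℂ) (w : ℂ) : ℂ × ℂ →L[ℝ] ℂ × ℂ :=
  ((((P w (ξ₁ w))⁻¹) • ContinuousLinearMap.id ℂ ℂ).restrictScalars ℝ).prodMap (𝒥.Q₁ w)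

/-- Pointwise formula for `Mmat₀`. [folklore] -/
@[simp] theorem Mmat₀_apply (ξ₀ : ℂ → ℂ) (z : ℂ) (v : ℂ × ℂ) :
    𝒥.Mmat₀ ξ₀ z v = ((P z (ξ₀ z))⁻¹ * v.1, 𝒥.Q₀ z v.2) := by
  simp [Mmat₀, Prod.map, smul_eq_mul]

/-- Pointwise formula for `Mmat₁`. [folklore] -/
@[simp] theorem Mmat₁_apply (ξ₁ : ℂ → ℂ) (w : ℂ) (v : ℂ × ℂ) :
    𝒥.Mmat₁ ξ₁ w v = ((P w (ξ₁ w))⁻¹ * v.1, 𝒥.Q₁ w v.2) := by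
  simp [Mmat₁, Prod.map, smul_eq_mul]

/-- The complex-linear transport `Φ₀ = clPart (J₀ (vmap₀ z)) (Mmat₀ z)`. [cite: Wendl2018, §2.3] -/
def Phi₀ (ξ₀ f₀ : ℂ → ℂ) (z : ℂ) : ℂ × ℂ →L[ℝ] ℂ × ℂ :=
  clPart (𝒥.J₀ (𝒥.vmap₀ ξ₀ f₀ z)) (𝒥.Mmat₀ ξ₀ z)

/-- The complex-linear transport in chart `1`. [cite: Wendl2018, §2.3] -/
def Phi₁ (ξ₁ f₁ : ℂ → ℂ) (w : ℂ) : ℂ × ℂ →L[ℝ] ℂ × ℂ :=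
  clPart (𝒥.J₁ (𝒥.vmap₁ ξ₁ f₁ w)) (𝒥.Mmat₁ ξ₁ w)

/-- **The Cauchy–Riemann operator in chart `0`**, with values in the fixed bundle:
`Φ₀ z (crExpr J₀ (vmap₀ ξ₀ f₀) z)`. [cite: Wendl2018, Thm. 2.46] -/
def crOp₀ (ξ₀ f₀ : ℂ → ℂ) (z : ℂ) : ℂ × ℂ :=
  𝒥.Phi₀ ξ₀ f₀ z (crExpr 𝒥.J₀ (𝒥.vmap₀ ξ₀ f₀) z)

/-- **The Cauchy–Riemann operator in chart `1`.** [cite: Wendl2018, Thm. 2.46] -/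
def crOp₁ (ξ₁ f₁ : ℂ → ℂ) (w : ℂ) : ℂ × ℂ :=
  𝒥.Phi₁ ξ₁ f₁ w (crExpr 𝒥.J₁ (𝒥.vmap₁ ξ₁ f₁) w)

/-! ### The zero section is a zero of the operator -/

/-- At the zero section (`ξ = 0`, `f = 0`) the chart-`0` map is the axis `z ↦ (z, 0)`.
[folklore] -/
theorem vmap₀_zero (z : ℂ) : 𝒥.vmap₀ 0 0 z = (z, 0) := by
  simp [vmap₀]

/-- The zero section is a zero of the chart-`0` Cauchy–Riemann operator (`axis₀`).
[cite: Wendl2018, Thm. 2.46] -/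
theorem crOp₀_zero (z : ℂ) : 𝒥.crOp₀ 0 0 z = 0 := by
  have hv : 𝒥.vmap₀ 0 0 = fun z => (z, 0) := funext 𝒥.vmap₀_zero
  have hcr : crExpr 𝒥.J₀ (𝒥.vmap₀ 0 0) z = 0 := by
    rw [hv, crExpr_def]
    have hd : HasFDerivAt (fun z : ℂ => ((z, 0) : ℂ × ℂ)) (ContinuousLinearMap.inl ℝ ℂ ℂ) z :=
      (hasFDerivAt_id z).prodMk (hasFDerivAt_const _ _)
    rw [hd.fderiv, ContinuousLinearMap.inl_apply, ContinuousLinearMap.inl_apply, 𝒥.axis₀]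
    ext <;> simp
  rw [crOp₀, hcr, map_zero]

/-- At the zero section the chart-`1` map is the axis `w ↦ (w, 0)`. [folklore] -/
theorem vmap₁_zero (w : ℂ) : 𝒥.vmap₁ 0 0 w = (w, 0) := by
  simp [vmap₁]

/-- The zero section is a zero of the chart-`1` Cauchy–Riemann operator (`axis₁`).
[cite: Wendl2018, Thm. 2.46] -/
theorem crOp₁_zero (w : ℂ) : 𝒥.crOp₁ 0 0 w = 0 := by
  have hv : 𝒥.vmap₁ 0 0 = fun w => (w, 0) := funext 𝒥.vmap₁_zero
  have hcr : crExpr 𝒥.J₁ (𝒥.vmap₁ 0 0) w = 0 := by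
    rw [hv, crExpr_def]
    have hd : HasFDerivAt (fun w : ℂ => ((w, 0) : ℂ × ℂ)) (ContinuousLinearMap.inl ℝ ℂ ℂ) w :=
      (hasFDerivAt_id w).prodMk (hasFDerivAt_const _ _)
    rw [hd.fderiv, ContinuousLinearMap.inl_apply, ContinuousLinearMap.inl_apply, 𝒥.axis₁]
    ext <;> simp
  rw [crOp₁, hcr, map_zero]

/-! ### The clutching law on the overlap -/

section Overlap

variable {ξ₀ f₀ ξ₁ f₁ : ℂ → ℂ} {z : ℂ}

/-- On the overlap the chart-`1` map is the chart change of the chart-`0` map precomposed with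
inversion: `vmap₁ ξ₁ f₁ =ᶠ[𝓝 z⁻¹] psi ∘ vmap₀ ξ₀ f₀ ∘ (·)⁻¹`, given the clutching relations of
`ξ` (a vector field) and `f` (a function) near `z⁻¹`. [cite: Wendl2018, §2.3] -/
theorem vmap₁_eventuallyEq (hz : z ≠ 0)
    (hξ : ξ₁ =ᶠ[𝓝 z⁻¹] fun w => -w ^ 2 * ξ₀ w⁻¹) (hf : f₁ =ᶠ[𝓝 z⁻¹] fun w => f₀ w⁻¹) :
    𝒥.vmap₁ ξ₁ f₁ =ᶠ[𝓝 z⁻¹] psi ∘ 𝒥.vmap₀ ξ₀ f₀ ∘ fun w => w⁻¹ := by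
  have hne : ∀ᶠ w in 𝓝 z⁻¹, w ≠ 0 := isOpen_ne.mem_nhds (inv_ne_zero hz)
  filter_upwards [hξ, hf, hne] with w hw hfw hw0
  show (expChart w (ξ₁ w), 𝒥.Qinv₁ w (f₁ w)) =
    ((expChart w⁻¹ (ξ₀ w⁻¹))⁻¹, 𝒥.Qinv₀ w⁻¹ (f₀ w⁻¹))
  rw [hw, hfw, 𝒥.Qinv₁_eq w hw0, inv_expChart_inv hw0]

/-- **THE CLUTCHING LAW.** On the overlap (`z ≠ 0`, `w = z⁻¹`), under the clutching relations
of `ξ` and `f` near `w`, differentiability of `ξ₀, f₀` at `z`, and the nondegeneracy of the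
exponential chart at `(z, ξ₀ z)`, the two chart expressions of the Cauchy–Riemann operator are
related by the clutching functions of `(0,1)`-forms with values in `T ℂℙ¹ ⊕ ℂ`:
`crOp₁ ξ₁ f₁ w = ((w² w̄⁻²) (crOp₀ ξ₀ f₀ z).1, (-w̄⁻²) (crOp₀ ξ₀ f₀ z).2)`.
[cite: Wendl2018, Thm. 2.46] -/
theorem crOp₁_eq (hz : z ≠ 0) (hξd : DifferentiableAt ℝ ξ₀ z) (hfd : DifferentiableAt ℝ f₀ z)
    (hξ : ξ₁ =ᶠ[𝓝 z⁻¹] fun w => -w ^ 2 * ξ₀ w⁻¹) (hf : f₁ =ᶠ[𝓝 z⁻¹] fun w => f₀ w⁻¹)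
    (hden : den z (ξ₀ z) ≠ 0) (hnum : z * (1 + (Complex.normSq z : ℂ)) + ξ₀ z ≠ 0) :
    𝒥.crOp₁ ξ₁ f₁ z⁻¹ =
      ((z⁻¹ ^ 2 * ((starRingEnd ℂ) z⁻¹)⁻¹ ^ 2) * (𝒥.crOp₀ ξ₀ f₀ z).1,
        (-((starRingEnd ℂ) z⁻¹)⁻¹ ^ 2) * (𝒥.crOp₀ ξ₀ f₀ z).2) := by
  -- notation
  set w : ℂ := z⁻¹ with hw
  have hw0 : w ≠ 0 := inv_ne_zero hz
  have hwz : w⁻¹ = z := by rw [hw, inv_inv]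
  set x : ℂ × ℂ := 𝒥.vmap₀ ξ₀ f₀ z with hx
  have hZ : x.1 ≠ 0 := by
    rw [hx, vmap₀]
    exact fun h => hnum ((expChart_eq_zero_iff hden).1 h)
  -- values of `ξ₁`, `f₁` at `w`
  have hξw : ξ₁ w = -w ^ 2 * ξ₀ z := by rw [hξ.eq_of_nhds, hwz]
  -- differentiability of the chart-0 map at `z`
  have hv0 : DifferentiableAt ℝ (𝒥.vmap₀ ξ₀ f₀) z := by
    refine DifferentiableAt.prodMk ?_ ?_
    · exact (hasFDerivAt_expChart_comp hξd.hasFDerivAt hden).differentiableAt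
    · have hQ : DifferentiableAt ℝ 𝒥.Qinv₀ z :=
        (𝒥.contDiff_Qinv₀_and.1.differentiable (by simp)).differentiableAt
      exact hQ.clm_apply hfd
  have hinvd : HasDerivAt (fun w : ℂ => w⁻¹) (-(w ^ 2)⁻¹) w := hasDerivAt_inv hw0
  have hv0' : DifferentiableAt ℝ (𝒥.vmap₀ ξ₀ f₀ ∘ fun w : ℂ => w⁻¹) w :=
    (hwz ▸ hv0).comp w (hinvd.differentiableAt.restrictScalars ℝ)
  -- Step A: replace `vmap₁` by `psi ∘ vmap₀ ∘ inv` in the Cauchy–Riemann expression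
  have hev := 𝒥.vmap₁_eventuallyEq hz hξ hf
  have hval : 𝒥.vmap₁ ξ₁ f₁ w = psi x := by
    have h := hev.eq_of_nhds
    simpa [Function.comp_apply, hwz] using h
  have hA : crExpr 𝒥.J₁ (𝒥.vmap₁ ξ₁ f₁) w =
      crExpr 𝒥.J₁ (psi ∘ 𝒥.vmap₀ ξ₀ f₀ ∘ fun w => w⁻¹) w := by
    rw [crExpr_def, crExpr_def, hev.fderiv_eq, hev.eq_of_nhds]
  -- Step B: the target chart change
  have hpsid : HasFDerivAt psi (dPsi x) x := hasFDerivAt_psi hZ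
  have hxw : (𝒥.vmap₀ ξ₀ f₀ ∘ fun w : ℂ => w⁻¹) w = x := by
    simp [Function.comp_apply, hwz, hx]
  have hB : crExpr 𝒥.J₁ (psi ∘ 𝒥.vmap₀ ξ₀ f₀ ∘ fun w => w⁻¹) w =
      dPsi x (crExpr 𝒥.J₀ (𝒥.vmap₀ ξ₀ f₀ ∘ fun w => w⁻¹) w) := by
    have h := crExpr_comp_left (J := 𝒥.J₀) (J' := 𝒥.J₁) (Ψ := psi)
      (v := 𝒥.vmap₀ ξ₀ f₀ ∘ fun w : ℂ => w⁻¹) (z := w)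
      (hxw ▸ hpsid.differentiableAt) hv0' ?_
    · rw [h, hxw, hpsid.fderiv]
    · intro y
      rw [hxw, hpsid.fderiv]
      exact 𝒥.compat x hZ y
  -- Step C: the domain reparametrisation by inversion
  have hC : crExpr 𝒥.J₀ (𝒥.vmap₀ ξ₀ f₀ ∘ fun w => w⁻¹) w =
      (-(w ^ 2)⁻¹).re • crExpr 𝒥.J₀ (𝒥.vmap₀ ξ₀ f₀) z -
        (-(w ^ 2)⁻¹).im • 𝒥.J₀ x (crExpr 𝒥.J₀ (𝒥.vmap₀ ξ₀ f₀) z) := by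
    have h := crExpr_comp_holomorphic (J := 𝒥.J₀) (v := 𝒥.vmap₀ ξ₀ f₀) hinvd (hwz ▸ hv0)
      (fun y => 𝒥.sq₀ _ y)
    simpa only [hwz] using h
  -- Step D: the transports: `Φ₁ w ∘ dPsi x = L ∘ Φ₀ z`
  set Lc : ℂ × ℂ →L[ℂ] ℂ × ℂ :=
    ((-w ^ 2) • ContinuousLinearMap.id ℂ ℂ).prodMap (ContinuousLinearMap.id ℂ ℂ) with hLc
  have hLc_apply : ∀ v : ℂ × ℂ, Lc v = (-w ^ 2 * v.1, v.2) := fun v => by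
    simp [hLc, Prod.map, neg_mul]
  have hP : P w (ξ₁ w) * x.1 ^ 2 = z ^ 2 * P z (ξ₀ z) := by
    rw [hξw, hx, vmap₀, hw]
    exact P_inv hz hden hnum
  have hMM : (𝒥.Mmat₁ ξ₁ w).comp (dPsi x) = (Lc.restrictScalars ℝ).comp (𝒥.Mmat₀ ξ₀ z) := by
    refine ContinuousLinearMap.ext fun v => Prod.ext ?_ ?_
    · simp only [ContinuousLinearMap.comp_apply, Mmat₁_apply, dPsi_apply,
        ContinuousLinearMap.coe_restrictScalars', hLc_apply, Mmat₀_apply]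
      -- `(P w c₁)⁻¹ * (-(Z²)⁻¹ * a) = -w² * ((P z c)⁻¹ * a)`
      have h2 : (P w (ξ₁ w))⁻¹ * (x.1 ^ 2)⁻¹ = (z ^ 2 * P z (ξ₀ z))⁻¹ := by rw [← mul_inv, hP]
      calc (P w (ξ₁ w))⁻¹ * (-(x.1 ^ 2)⁻¹ * v.1)
          = -((P w (ξ₁ w))⁻¹ * (x.1 ^ 2)⁻¹) * v.1 := by ring
        _ = -(z ^ 2 * P z (ξ₀ z))⁻¹ * v.1 := by rw [h2]
        _ = -w ^ 2 * ((P z (ξ₀ z))⁻¹ * v.1) := by rw [hw, mul_inv, inv_pow]; ring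
    · simp only [ContinuousLinearMap.comp_apply, Mmat₁_apply, dPsi_apply,
        ContinuousLinearMap.coe_restrictScalars', hLc_apply, Mmat₀_apply, 𝒥.Q₁_eq w hw0, hwz]
  have hD : ∀ Y : ℂ × ℂ, 𝒥.Phi₁ ξ₁ f₁ w (dPsi x Y) = Lc (𝒥.Phi₀ ξ₀ f₀ z Y) := by
    intro Y
    have h1 : (𝒥.Phi₁ ξ₁ f₁ w).comp (dPsi x) =
        clPart (𝒥.J₀ x) ((𝒥.Mmat₁ ξ₁ w).comp (dPsi x)) := by
      rw [Phi₁, hval]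
      exact clPart_comp_of_intertwine (J := 𝒥.J₀ x) (J' := 𝒥.J₁ (psi x)) (dPsi x)
        (fun y => 𝒥.compat x hZ y) _
    have h2 := congrArg (fun T : ℂ × ℂ →L[ℝ] ℂ × ℂ => T Y) h1
    simp only [ContinuousLinearMap.comp_apply] at h2
    rw [h2, hMM, clPart_comp_complexLinear, ContinuousLinearMap.comp_apply,
      ContinuousLinearMap.coe_restrictScalars']
    rfl
  -- Step E: assemble
  have hconj : (starRingEnd ℂ) (-(w ^ 2)⁻¹) = -((starRingEnd ℂ) w)⁻¹ ^ 2 := by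
    simp [map_neg, map_inv₀, map_pow, inv_pow]
  have hE : 𝒥.Phi₀ ξ₀ f₀ z ((-(w ^ 2)⁻¹).re • crExpr 𝒥.J₀ (𝒥.vmap₀ ξ₀ f₀) z -
        (-(w ^ 2)⁻¹).im • 𝒥.J₀ x (crExpr 𝒥.J₀ (𝒥.vmap₀ ξ₀ f₀) z)) =
      (starRingEnd ℂ) (-(w ^ 2)⁻¹) • 𝒥.crOp₀ ξ₀ f₀ z := by
    rw [crOp₀, Phi₀, ← hx]
    exact clPart_apply_re_sub_im (fun y => 𝒥.sq₀ x y) (𝒥.Mmat₀ ξ₀ z) _ _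
  rw [crOp₁, hA, hB, hC, hD, hE, hconj, hLc_apply]
  refine Prod.ext ?_ ?_
  · simp only [Prod.smul_fst, smul_eq_mul]
    ring
  · simp only [Prod.smul_snd, smul_eq_mul]

end Overlap

end SphereACData

end SphereCR

end Literature.Geometry.Symplectic

end
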